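import Literature.Probability.Percolation.OneArmLSWProofs
import Literature.Probability.Percolation.TriSubcriticalCrossing
import Literature.Probability.Percolation.BrickHex
import HarnessLib

/-!
# Open and closed blocking circuits of `𝕋` around a lattice point at many scales (`p = 1/2`)

Topic: Probability / Percolation. The probabilistic input for the non-triviality of the scaling
limits of the critical site-percolation loop ensemble (F. Camia, C. M. Newman, Comm. Math.
Phys. 268 (2006), Thm 2 (ii): every point is surrounded by infinitely many loops; proof: RSW
circuits of both colours occur in every dyadic annulus with probability bounded below, and
disjoint annuli are independent): the RSW annulus circuits of Bollobás–Riordan (*Percolation*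
(2006), Ch. 7, proof of Lemma 4 — the tree's PROVED fact `BollobasRiordan2006_openCircuit_holds`,
`OneArmLSWProofs.lean`: for `R ≥ 1000`, with probability `≥ c > 0` some open circuit of `𝕋` in
`R < ‖·‖ < 2R` meets every walk from `‖x‖ ≤ R` to `‖y‖ ≥ 2R`), transported to an arbitrary
centre and to closed circuits, and combined over scales:

* `IsBlockingCircuitAround S c r₁ r₂ O` — the closed walk `O` of `𝕋` has all its sites in `S`
  and in the annulus `r₁ < ‖· - c‖ < r₂` (Euclidean embedding) and meets every walk of `𝕋` from
  `‖x - c‖ ≤ r₁` to `‖y - c‖ ≥ r₂`; `triOpenCircuitAround c r₁ r₂` (`S = ω`),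
  `triClosedCircuitAround c r₁ r₂` (`S = ωᶜ`); for `c = 0` the former is `triOpenCircuit r₁ r₂`;
* translation (`IsBlockingCircuitAround.shift`, `triShiftIso`) and the invariance of `P_{1/2}`
  under translations (`sitePercolation_real_preimage_relabel`) and under the colour flip
  (`triSitePercolation_half_real_preimage_compl`) give
  `P(triOpenCircuitAround c R 2R) = P(triClosedCircuitAround c R 2R) = P(triOpenCircuit R 2R) ≥ c`;
* both events are increasing/decreasing local events determined by the sites of the annulus
  (`determinedBy_triOpenCircuitAround`), so events in disjoint annuli are independent
  (`sitePercolation_real_inter_of_disjoint`): the **circuit triple** `circuitTriple c R` (open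
  circuit in `(4R, 8R)`, closed circuits in `(16R, 32R)` and `(64R, 128R)`) has probability
  `≥ c³` (`le_real_circuitTriple`), and over the geometric scales `R_j = R₀ · 1024^j` the event
  that each of `k` consecutive blocks of `m` scales contains a scale with a circuit triple has
  probability `≥ 1 - k (1 - c³)^m` (`le_real_goodScales`).

Everything is proved; no named facts are introduced.

## References

* B. Bollobás, O. Riordan, *Percolation*, CUP (2006), Ch. 7, Lemma 4 (p. 167) [BollobasRiordan2006].
* F. Camia, C. M. Newman, Comm. Math. Phys. 268 (2006), Thm 2 (ii) and its proof [CamiaNewman2006].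
* G. Grimmett, *Percolation*, 2nd ed. (1999), §2.2 (independence on disjoint sets), §11.7 (RSW).
-/

noncomputable section

open Set MeasureTheory

namespace Literature.Probability.Percolation

open LatticeModels

/-! ### Blocking circuits around a centre -/

/-- **A blocking circuit around `c` in the annulus `r₁ < ‖· - c‖ < r₂` with sites in `S`**: the
closed walk `O` of `𝕋` has all its sites in `S` and (embedded) in the open annulus, and every walk
of `𝕋` from the disc `‖x - c‖ ≤ r₁` to the region `‖y - c‖ ≥ r₂` meets it (the separating circuits
of Bollobás–Riordan 2006, Ch. 7 Lemma 4, and LSW 2002 §3, about an arbitrary centre).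
[cite: BollobasRiordan2006, Ch. 7, proof of Lemma 4 (p. 167)] -/
def IsBlockingCircuitAround (S : Set (Site 2)) (c : Site 2) (r₁ r₂ : ℝ) {v : Site 2}
    (O : triGraph.Walk v v) : Prop :=
  (∀ x ∈ O.support, x ∈ S ∧ r₁ < ‖triEmbed (x - c)‖ ∧ ‖triEmbed (x - c)‖ < r₂) ∧
    ∀ (x y : Site 2) (q : triGraph.Walk x y), ‖triEmbed (x - c)‖ ≤ r₁ → r₂ ≤ ‖triEmbed (y - c)‖ →
      ∃ z ∈ q.support, z ∈ O.support

/-- The event "some **open** circuit around `c` blocks the annulus `(r₁, r₂)`".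
[cite: BollobasRiordan2006, Ch. 7, proof of Lemma 4 (p. 167)] -/
def triOpenCircuitAround (c : Site 2) (r₁ r₂ : ℝ) : Set (SiteConfig (Site 2)) :=
  {ω | ∃ (v : Site 2) (O : triGraph.Walk v v), IsBlockingCircuitAround ω c r₁ r₂ O}

/-- The event "some **closed** circuit around `c` blocks the annulus `(r₁, r₂)`": the colour
flip of `triOpenCircuitAround`. [cite: BollobasRiordan2006, Ch. 7, proof of Lemma 4 (p. 167)] -/
def triClosedCircuitAround (c : Site 2) (r₁ r₂ : ℝ) : Set (SiteConfig (Site 2)) :=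
  compl ⁻¹' triOpenCircuitAround c r₁ r₂

/-- Membership in `triClosedCircuitAround`, unfolded: a blocking circuit of closed sites. [folklore] -/
theorem mem_triClosedCircuitAround_iff {c : Site 2} {r₁ r₂ : ℝ} {ω : SiteConfig (Site 2)} :
    ω ∈ triClosedCircuitAround c r₁ r₂ ↔
      ∃ (v : Site 2) (O : triGraph.Walk v v), IsBlockingCircuitAround ωᶜ c r₁ r₂ O :=
  Iff.rfl

/-- Around the origin, `triOpenCircuitAround` is the event `triOpenCircuit` of `OneArmLSW.lean`.
[folklore] -/
theorem triOpenCircuitAround_zero (r₁ r₂ : ℝ) : triOpenCircuitAround 0 r₁ r₂ = triOpenCircuit r₁ r₂ := by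
  ext ω
  simp only [triOpenCircuitAround, IsBlockingCircuitAround, sub_zero, mem_setOf_eq, mem_triOpenCircuit_iff]

/-- **Translating a blocking circuit**: shifting all sites by `d` turns a blocking circuit
around `c` with sites in `S` into one around `c + d` with sites in `S + d`. [folklore] -/
theorem IsBlockingCircuitAround.shift {S : Set (Site 2)} {c : Site 2} {r₁ r₂ : ℝ} {v : Site 2}
    {O : triGraph.Walk v v} (h : IsBlockingCircuitAround S c r₁ r₂ O) (d : Site 2) :
    IsBlockingCircuitAround (Site.shift d '' S) (c + d) r₁ r₂ (O.map (triShiftIso d).toHom) := by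
  obtain ⟨hS, hblock⟩ := h
  constructor
  · intro x hx
    rw [SimpleGraph.Walk.support_map, List.mem_map] at hx
    obtain ⟨x₀, hx₀, rfl⟩ := hx
    obtain ⟨h1, h2, h3⟩ := hS x₀ hx₀
    have e : (triShiftIso d).toHom x₀ - (c + d) = x₀ - c := by
      change x₀ + d - (c + d) = x₀ - c; abel
    rw [e]
    exact ⟨⟨x₀, h1, rfl⟩, h2, h3⟩
  · intro x y q hx hy
    have hx' : ‖triEmbed (x + -d - c)‖ ≤ r₁ := by
      rwa [show x + -d - c = x - (c + d) by abel]
    have hy' : r₂ ≤ ‖triEmbed (y + -d - c)‖ := by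
      rwa [show y + -d - c = y - (c + d) by abel]
    obtain ⟨z, hzq, hzO⟩ := hblock _ _ (q.map (triShiftIso (-d)).toHom) hx' hy'
    rw [SimpleGraph.Walk.support_map, List.mem_map] at hzq
    obtain ⟨z₀, hz₀, rfl⟩ := hzq
    refine ⟨z₀, hz₀, ?_⟩
    rw [SimpleGraph.Walk.support_map, List.mem_map]
    refine ⟨_, hzO, ?_⟩
    change z₀ + -d + d = z₀
    abel

/-- **`triOpenCircuitAround c` is the translate of `triOpenCircuit`**: `ω` has an open blocking
circuit around `c` iff the configuration shifted by `-c` has one around the origin. [folklore] -/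
theorem mem_triOpenCircuitAround_iff_shift {c : Site 2} {r₁ r₂ : ℝ} {ω : SiteConfig (Site 2)} :
    ω ∈ triOpenCircuitAround c r₁ r₂ ↔ Site.shift (-c) '' ω ∈ triOpenCircuit r₁ r₂ := by
  rw [← triOpenCircuitAround_zero]
  constructor
  · rintro ⟨v, O, hO⟩
    have h := hO.shift (-c)
    rw [add_neg_cancel] at h
    exact ⟨_, _, h⟩
  · rintro ⟨v, O, hO⟩
    have h := hO.shift c
    rw [zero_add, Set.image_image] at h
    have e : (fun x ↦ Site.shift c (Site.shift (-c) x)) = id := by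
      funext x; change x + -c + c = x; abel
    rw [e, Set.image_id] at h
    exact ⟨_, _, h⟩

/-- The event as a preimage under the relabelling of configurations by the shift `x ↦ x - c`.
[folklore] -/
theorem triOpenCircuitAround_eq_preimage_relabel (c : Site 2) (r₁ r₂ : ℝ) :
    triOpenCircuitAround c r₁ r₂ = SiteConfig.relabel (Site.shift (-c)) ⁻¹' triOpenCircuit r₁ r₂ := by
  ext ω
  rw [mem_triOpenCircuitAround_iff_shift, mem_preimage, SiteConfig.relabel_apply]

/-- **Translation invariance**: at every density, the open blocking circuit around `c` has the
same probability as around the origin (`sitePercolation_real_preimage_relabel`).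
[cite: BollobasRiordan2006, Ch. 7, proof of Lemma 4 (p. 167)] -/
theorem real_triOpenCircuitAround (p : unitInterval) (c : Site 2) (r₁ r₂ : ℝ) :
    (triSitePercolation p).real (triOpenCircuitAround c r₁ r₂) =
      (triSitePercolation p).real (triOpenCircuit r₁ r₂) := by
  rw [triOpenCircuitAround_eq_preimage_relabel, triSitePercolation_eq,
    sitePercolation_real_preimage_relabel]

/-- **Colour-flip symmetry at `p = 1/2`**: the closed blocking circuit around `c` has the same
probability as the open one (`triSitePercolation_half_real_preimage_compl`).
[cite: BollobasRiordan2006, Ch. 7, proof of Lemma 4 (p. 167)] -/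
theorem real_triClosedCircuitAround_half (c : Site 2) (r₁ r₂ : ℝ) :
    (triSitePercolation half).real (triClosedCircuitAround c r₁ r₂) =
      (triSitePercolation half).real (triOpenCircuit r₁ r₂) := by
  rw [triClosedCircuitAround, triSitePercolation_half_real_preimage_compl, real_triOpenCircuitAround]

/-- **The RSW lower bound around an arbitrary centre, for both colours**: there is `c₀ > 0` such
that for every lattice point `c` and every `R ≥ 1000`, at `p = 1/2` both the open and the closed
blocking circuit around `c` in `(R, 2R)` have probability `≥ c₀`
(`BollobasRiordan2006_openCircuit_holds`). [cite: BollobasRiordan2006, Ch. 7, proof of Lemma 4 (p. 167)] -/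
theorem exists_pos_le_real_circuitAround :
    ∃ c₀ : ℝ, 0 < c₀ ∧ ∀ (c : Site 2) (R : ℝ), 1000 ≤ R →
      c₀ ≤ (triSitePercolation half).real (triOpenCircuitAround c R (2 * R)) ∧
        c₀ ≤ (triSitePercolation half).real (triClosedCircuitAround c R (2 * R)) := by
  obtain ⟨c₀, hc₀, h⟩ := BollobasRiordan2006_openCircuit_holds
  refine ⟨c₀, hc₀, fun c R hR ↦ ⟨?_, ?_⟩⟩
  · rw [real_triOpenCircuitAround]; exact h R hR
  · rw [real_triClosedCircuitAround_half]; exact h R hR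

/-! ### Locality -/

/-- The sites of the annulus `r₁ < ‖· - c‖ < r₂`. [folklore] -/
def annulusSites (c : Site 2) (r₁ r₂ : ℝ) : Set (Site 2) :=
  {v | r₁ < ‖triEmbed (v - c)‖ ∧ ‖triEmbed (v - c)‖ < r₂}

/-- `triOpenCircuitAround c r₁ r₂` is determined by the sites of the annulus. [folklore] -/
theorem determinedBy_triOpenCircuitAround (c : Site 2) (r₁ r₂ : ℝ) :
    DeterminedBy (triOpenCircuitAround c r₁ r₂) (annulusSites c r₁ r₂) := by
  rw [determinedBy_iff]
  suffices key : ∀ ω ω' : Set (Site 2), ω ∩ annulusSites c r₁ r₂ = ω' ∩ annulusSites c r₁ r₂ →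
      ω ∈ triOpenCircuitAround c r₁ r₂ → ω' ∈ triOpenCircuitAround c r₁ r₂ from
    fun ω ω' h ↦ ⟨key ω ω' h, key ω' ω h.symm⟩
  rintro ω ω' h ⟨v, O, hO, hsep⟩
  refine ⟨v, O, fun x hx ↦ ⟨?_, (hO x hx).2⟩, hsep⟩
  have : x ∈ ω ∩ annulusSites c r₁ r₂ := ⟨(hO x hx).1, (hO x hx).2⟩
  rw [h] at this
  exact this.1

/-- A colour-flipped event is determined by the same sites. [folklore] -/
theorem DeterminedBy.preimage_compl {ι : Type*} {A : Set (Set ι)} {F : Set ι} (h : DeterminedBy A F) :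
    DeterminedBy (Compl.compl ⁻¹' A) F := by
  rw [determinedBy_iff] at h ⊢
  intro ω ω' hω
  rw [mem_preimage, mem_preimage]
  refine h ωᶜ ω'ᶜ ?_
  rw [← sdiff_eq_compl_inter, ← sdiff_eq_compl_inter, Set.ext_iff] at *
  intro x
  have hx := hω x
  simp only [mem_inter_iff, mem_sdiff] at hx ⊢
  tauto

/-- `triClosedCircuitAround c r₁ r₂` is determined by the sites of the annulus. [folklore] -/
theorem determinedBy_triClosedCircuitAround (c : Site 2) (r₁ r₂ : ℝ) :
    DeterminedBy (triClosedCircuitAround c r₁ r₂) (annulusSites c r₁ r₂) :=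
  (determinedBy_triOpenCircuitAround c r₁ r₂).preimage_compl

/-- The sites of the annulus `r₁ < ‖· - c‖ < r₂`, as a finite set (inside a box about the
origin of size `⌈2 (r₂ + ‖c‖)⌉`). [folklore] -/
def annulusFinset (c : Site 2) (r₁ r₂ : ℝ) : Finset (Site 2) :=
  (box 2 ⌈2 * (r₂ + ‖triEmbed c‖)⌉₊).filter fun v ↦ r₁ < ‖triEmbed (v - c)‖ ∧ ‖triEmbed (v - c)‖ < r₂

/-- The finite set of annulus sites is the set of annulus sites. [folklore] -/
theorem coe_annulusFinset (c : Site 2) (r₁ r₂ : ℝ) :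
    (annulusFinset c r₁ r₂ : Set (Site 2)) = annulusSites c r₁ r₂ := by
  ext v
  simp only [annulusFinset, Finset.coe_filter, mem_setOf_eq, annulusSites]
  constructor
  · exact fun h ↦ h.2
  · intro h
    refine ⟨mem_box_of_norm_triEmbed_le ?_, h⟩
    have e : triEmbed v = triEmbed (v - c) + triEmbed c := by
      rw [← triEmbed_add, sub_add_cancel]
    rw [e]
    exact (norm_add_le _ _).trans (by linarith [h.2])

/-- Membership in `annulusFinset`. [folklore] -/
theorem mem_annulusFinset_iff {c : Site 2} {r₁ r₂ : ℝ} {v : Site 2} :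
    v ∈ annulusFinset c r₁ r₂ ↔ r₁ < ‖triEmbed (v - c)‖ ∧ ‖triEmbed (v - c)‖ < r₂ := by
  rw [← Finset.mem_coe, coe_annulusFinset]; rfl

/-- Annuli with separated radii have disjoint site sets. [folklore] -/
theorem disjoint_annulusFinset {c : Site 2} {r₁ r₂ r₃ r₄ : ℝ} (h : r₂ ≤ r₃) :
    Disjoint (annulusFinset c r₁ r₂) (annulusFinset c r₃ r₄) := by
  rw [Finset.disjoint_left]
  intro v hv hv'
  rw [mem_annulusFinset_iff] at hv hv'
  linarith [hv.2, hv'.1]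

/-- The events are measurable (local events). [folklore] -/
theorem measurableSet_triOpenCircuitAround (c : Site 2) (r₁ r₂ : ℝ) :
    MeasurableSet (triOpenCircuitAround c r₁ r₂) :=
  DeterminedBy.measurableSet_of_finset (F := annulusFinset c r₁ r₂)
    (by rw [coe_annulusFinset]; exact determinedBy_triOpenCircuitAround c r₁ r₂)

/-- The closed-circuit events are measurable. [folklore] -/
theorem measurableSet_triClosedCircuitAround (c : Site 2) (r₁ r₂ : ℝ) :
    MeasurableSet (triClosedCircuitAround c r₁ r₂) :=
  DeterminedBy.measurableSet_of_finset (F := annulusFinset c r₁ r₂)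
    (by rw [coe_annulusFinset]; exact determinedBy_triClosedCircuitAround c r₁ r₂)

/-! ### The circuit triple at scale `R` -/

/-- **The circuit triple around `c` at scale `R`**: an open blocking circuit in `(4R, 8R)`, a
closed one in `(16R, 32R)` and a closed one in `(64R, 128R)` — the configuration of circuits
that forces, deterministically, a macroscopic cluster interface near scale `R` around `c`
(`MacroscopicInterfaceLoop.lean`) (Camia–Newman 2006, proof of Thm 2 (ii)). [folklore] -/
def circuitTriple (c : Site 2) (R : ℝ) : Set (SiteConfig (Site 2)) :=
  triOpenCircuitAround c (4 * R) (8 * R) ∩ triClosedCircuitAround c (16 * R) (32 * R) ∩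
    triClosedCircuitAround c (64 * R) (128 * R)

/-- The circuit triple is determined by the sites of the annulus `(4R, 128R)`. [folklore] -/
theorem determinedBy_circuitTriple (c : Site 2) {R : ℝ} (hR : 0 ≤ R) :
    DeterminedBy (circuitTriple c R) ↑(annulusFinset c (4 * R) (128 * R)) := by
  rw [coe_annulusFinset]
  have hmono : ∀ {r₁ r₂ : ℝ}, 4 * R ≤ r₁ → r₂ ≤ 128 * R →
      annulusSites c r₁ r₂ ⊆ annulusSites c (4 * R) (128 * R) :=
    fun h1 h2 v hv ↦ ⟨by linarith [hv.1], by linarith [hv.2]⟩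
  exact (((determinedBy_triOpenCircuitAround c _ _).mono (hmono le_rfl (by linarith))).inter
    ((determinedBy_triClosedCircuitAround c _ _).mono (hmono (by linarith) (by linarith)))).inter
    ((determinedBy_triClosedCircuitAround c _ _).mono (hmono (by linarith) le_rfl))

/-- The circuit triple is measurable. [folklore] -/
theorem measurableSet_circuitTriple (c : Site 2) {R : ℝ} (hR : 0 ≤ R) : MeasurableSet (circuitTriple c R) :=
  (determinedBy_circuitTriple c hR).measurableSet_of_finset

/-- **The circuit triple has probability at least `c₀³`** at `p = 1/2`, for every centre and
every `R ≥ 250` (the three circuits live in disjoint annuli, hence are independent,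
`sitePercolation_real_inter_of_disjoint`; each has probability `≥ c₀`).
[cite: CamiaNewman2006, Thm 2] -/
theorem le_real_circuitTriple {c₀ : ℝ}
    (h : ∀ (c : Site 2) (R : ℝ), 1000 ≤ R →
      c₀ ≤ (triSitePercolation half).real (triOpenCircuitAround c R (2 * R)) ∧
        c₀ ≤ (triSitePercolation half).real (triClosedCircuitAround c R (2 * R)))
    (hc₀ : 0 ≤ c₀) (c : Site 2) {R : ℝ} (hR : 250 ≤ R) :
    c₀ ^ 3 ≤ (triSitePercolation half).real (circuitTriple c R) := by
  have h1 := (h c (4 * R) (by linarith)).1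
  have h2 := (h c (16 * R) (by linarith)).2
  have h3 := (h c (64 * R) (by linarith)).2
  rw [show 2 * (4 * R) = 8 * R by ring] at h1
  rw [show 2 * (16 * R) = 32 * R by ring] at h2
  rw [show 2 * (64 * R) = 128 * R by ring] at h3
  have hd1 : DeterminedBy (triOpenCircuitAround c (4 * R) (8 * R)) ↑(annulusFinset c (4 * R) (8 * R)) := by
    rw [coe_annulusFinset]; exact determinedBy_triOpenCircuitAround c _ _
  have hd2 : DeterminedBy (triClosedCircuitAround c (16 * R) (32 * R)) ↑(annulusFinset c (16 * R) (32 * R)) := by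
    rw [coe_annulusFinset]; exact determinedBy_triClosedCircuitAround c _ _
  have hd3 : DeterminedBy (triClosedCircuitAround c (64 * R) (128 * R)) ↑(annulusFinset c (64 * R) (128 * R)) := by
    rw [coe_annulusFinset]; exact determinedBy_triClosedCircuitAround c _ _
  have hd12 : DeterminedBy (triOpenCircuitAround c (4 * R) (8 * R) ∩ triClosedCircuitAround c (16 * R) (32 * R))
      ↑(annulusFinset c (4 * R) (8 * R) ∪ annulusFinset c (16 * R) (32 * R)) := by
    rw [Finset.coe_union]
    exact (hd1.mono subset_union_left).inter (hd2.mono subset_union_right)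
  have hdisj12 : Disjoint (annulusFinset c (4 * R) (8 * R)) (annulusFinset c (16 * R) (32 * R)) :=
    disjoint_annulusFinset (by linarith)
  have hdisj3 : Disjoint (annulusFinset c (4 * R) (8 * R) ∪ annulusFinset c (16 * R) (32 * R))
      (annulusFinset c (64 * R) (128 * R)) := by
    rw [Finset.disjoint_union_left]
    exact ⟨disjoint_annulusFinset (by linarith), disjoint_annulusFinset (by linarith)⟩
  rw [circuitTriple, triSitePercolation_eq, sitePercolation_real_inter_of_disjoint half hd12 hd3 hdisj3,
    sitePercolation_real_inter_of_disjoint half hd1 hd2 hdisj12, ← triSitePercolation_eq]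
  calc c₀ ^ 3 = c₀ * c₀ * c₀ := by ring
    _ ≤ _ := by gcongr

/-! ### Many scales -/

/-- The geometric scales `R_j = R₀ · 1024^j`. [folklore] -/
def circuitScale (R₀ : ℝ) (j : ℕ) : ℝ := R₀ * 1024 ^ j

/-- The scales are at least `R₀` (for `R₀ ≥ 0`). [folklore] -/
theorem le_circuitScale {R₀ : ℝ} (hR₀ : 0 ≤ R₀) (j : ℕ) : R₀ ≤ circuitScale R₀ j :=
  le_mul_of_one_le_right hR₀ (one_le_pow₀ (by norm_num))

/-- The scales are nonnegative (for `R₀ ≥ 0`). [folklore] -/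
theorem circuitScale_nonneg {R₀ : ℝ} (hR₀ : 0 ≤ R₀) (j : ℕ) : 0 ≤ circuitScale R₀ j :=
  hR₀.trans (le_circuitScale hR₀ j)

/-- Consecutive scales differ by the factor `1024`. [folklore] -/
theorem circuitScale_succ (R₀ : ℝ) (j : ℕ) : circuitScale R₀ (j + 1) = 1024 * circuitScale R₀ j := by
  simp only [circuitScale, pow_succ]; ring

/-- The scales increase at least by the factor `1024` per step: `1024 R_i ≤ R_j` for `i < j`.
[folklore] -/
theorem mul_circuitScale_le {R₀ : ℝ} (hR₀ : 0 ≤ R₀) {i j : ℕ} (hij : i < j) :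
    1024 * circuitScale R₀ i ≤ circuitScale R₀ j := by
  rw [← circuitScale_succ]
  simp only [circuitScale]
  exact mul_le_mul_of_nonneg_left (pow_le_pow_right₀ (by norm_num) hij) hR₀

/-- The annuli `(4R_i, 128R_i)` of distinct scales are disjoint. [folklore] -/
theorem disjoint_annulusFinset_circuitScale {R₀ : ℝ} (hR₀ : 0 ≤ R₀) (c : Site 2) {i j : ℕ} (hij : i ≠ j) :
    Disjoint (annulusFinset c (4 * circuitScale R₀ i) (128 * circuitScale R₀ i))
      (annulusFinset c (4 * circuitScale R₀ j) (128 * circuitScale R₀ j)) := by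
  rcases lt_or_gt_of_ne hij with h | h
  · exact disjoint_annulusFinset (by linarith [mul_circuitScale_le hR₀ h, circuitScale_nonneg hR₀ i])
  · exact (disjoint_annulusFinset (by linarith [mul_circuitScale_le hR₀ h, circuitScale_nonneg hR₀ j])).symm

/-- **The good-scales event**: each of the `k` consecutive blocks `[gm, (g+1)m)` of scales
contains a scale `j` with a circuit triple around `c` at scale `R_j`. [folklore] -/
def goodScales (c : Site 2) (R₀ : ℝ) (k m : ℕ) : Set (SiteConfig (Site 2)) :=
  ⋂ g ∈ Finset.range k, ⋃ j ∈ Finset.Ico (g * m) ((g + 1) * m), circuitTriple c (circuitScale R₀ j)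

/-- The probability that a whole block of `m` scales has no circuit triple is at most
`(1 - c₀³)^m` (independence over the disjoint annuli of the block,
`sitePercolation_real_iInter_eq_prod`). [cite: CamiaNewman2006, Thm 2] -/
theorem real_iInter_compl_circuitTriple_le {c₀ : ℝ}
    (h : ∀ (c : Site 2) (R : ℝ), 1000 ≤ R →
      c₀ ≤ (triSitePercolation half).real (triOpenCircuitAround c R (2 * R)) ∧
        c₀ ≤ (triSitePercolation half).real (triClosedCircuitAround c R (2 * R)))
    (hc₀ : 0 ≤ c₀) (c : Site 2) {R₀ : ℝ} (hR₀ : 250 ≤ R₀) (a m : ℕ) :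
    (triSitePercolation half).real (⋂ i < m, (circuitTriple c (circuitScale R₀ (a + i)))ᶜ) ≤ (1 - c₀ ^ 3) ^ m := by
  have hR₀' : 0 ≤ R₀ := by linarith
  have hY : ∀ i < m, DeterminedBy (circuitTriple c (circuitScale R₀ (a + i)))ᶜ
      ↑(annulusFinset c (4 * circuitScale R₀ (a + i)) (128 * circuitScale R₀ (a + i))) :=
    fun i _ ↦ (determinedBy_circuitTriple c (circuitScale_nonneg hR₀' _)).compl
  have hF : ∀ i j, i < j → j < m →
      Disjoint (annulusFinset c (4 * circuitScale R₀ (a + i)) (128 * circuitScale R₀ (a + i)))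
        (annulusFinset c (4 * circuitScale R₀ (a + j)) (128 * circuitScale R₀ (a + j))) :=
    fun i j hij _ ↦ disjoint_annulusFinset_circuitScale hR₀' c (by omega)
  rw [triSitePercolation_eq, sitePercolation_real_iInter_eq_prod half hY hF, ← triSitePercolation_eq]
  calc ∏ i ∈ Finset.range m, (triSitePercolation half).real (circuitTriple c (circuitScale R₀ (a + i)))ᶜ
      ≤ ∏ _i ∈ Finset.range m, (1 - c₀ ^ 3) :=
        Finset.prod_le_prod (fun _ _ ↦ measureReal_nonneg) fun i _ ↦ by
          rw [measureReal_compl (measurableSet_circuitTriple c (circuitScale_nonneg hR₀' _)), probReal_univ]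
          have := le_real_circuitTriple h hc₀ c (le_trans hR₀ (le_circuitScale hR₀' (a + i)))
          linarith
    _ = (1 - c₀ ^ 3) ^ m := by rw [Finset.prod_const, Finset.card_range]

/-- **Probability of the good-scales event**: at `p = 1/2`, for `R₀ ≥ 250` and every centre,
`P(goodScales c R₀ k m) ≥ 1 - k (1 - c₀³)^m` (union bound over the `k` blocks and the block
estimate `real_iInter_compl_circuitTriple_le`). [cite: CamiaNewman2006, Thm 2] -/
theorem le_real_goodScales {c₀ : ℝ}
    (h : ∀ (c : Site 2) (R : ℝ), 1000 ≤ R →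
      c₀ ≤ (triSitePercolation half).real (triOpenCircuitAround c R (2 * R)) ∧
        c₀ ≤ (triSitePercolation half).real (triClosedCircuitAround c R (2 * R)))
    (hc₀ : 0 ≤ c₀) (c : Site 2) {R₀ : ℝ} (hR₀ : 250 ≤ R₀) (k m : ℕ) :
    1 - k * (1 - c₀ ^ 3) ^ m ≤ (triSitePercolation half).real (goodScales c R₀ k m) := by
  have hR₀' : 0 ≤ R₀ := by linarith
  have hmeas : ∀ j, MeasurableSet (circuitTriple c (circuitScale R₀ j)) :=
    fun j ↦ measurableSet_circuitTriple c (circuitScale_nonneg hR₀' j)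
  have hgood : MeasurableSet (goodScales c R₀ k m) :=
    Finset.measurableSet_biInter _ fun g _ ↦ Finset.measurableSet_biUnion _ fun j _ ↦ hmeas j
  -- the complement is a union over blocks of "no triple in the block"
  have hcompl : (goodScales c R₀ k m)ᶜ ⊆
      ⋃ g ∈ Finset.range k, ⋂ i < m, (circuitTriple c (circuitScale R₀ (g * m + i)))ᶜ := by
    intro ω hω
    simp only [goodScales, mem_iInter, mem_compl_iff, not_forall, mem_iUnion, exists_prop, not_exists,
      not_and] at hω
    obtain ⟨g, hg, hno⟩ := hω
    simp only [mem_iUnion, mem_iInter, exists_prop, mem_compl_iff]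
    refine ⟨g, hg, fun i hi ↦ hno (g * m + i) ?_⟩
    rw [Finset.mem_Ico]; constructor <;> nlinarith
  have hbound : (triSitePercolation half).real (goodScales c R₀ k m)ᶜ ≤ k * (1 - c₀ ^ 3) ^ m := by
    calc (triSitePercolation half).real (goodScales c R₀ k m)ᶜ
        ≤ (triSitePercolation half).real
            (⋃ g ∈ Finset.range k, ⋂ i < m, (circuitTriple c (circuitScale R₀ (g * m + i)))ᶜ) :=
          measureReal_mono hcompl (measure_ne_top _ _)
      _ ≤ ∑ g ∈ Finset.range k, (triSitePercolation half).real
            (⋂ i < m, (circuitTriple c (circuitScale R₀ (g * m + i)))ᶜ) :=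
          measureReal_biUnion_finset_le _ _
      _ ≤ ∑ _g ∈ Finset.range k, (1 - c₀ ^ 3) ^ m :=
          Finset.sum_le_sum fun g _ ↦ real_iInter_compl_circuitTriple_le h hc₀ c hR₀ (g * m) m
      _ = k * (1 - c₀ ^ 3) ^ m := by rw [Finset.sum_const, Finset.card_range, nsmul_eq_mul]
  rw [measureReal_compl hgood, probReal_univ] at hbound
  linarith

end Literature.Probability.Percolation
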